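import Literature.Computability.MetaComplexity.Resolution
import HarnessLib

/-!
# Width-bounded resolution derivability (`ResDerivable`) and restrictions

Support library for the Ben-Sasson–Wigderson width method (Ben-Sasson–Wigderson 2001, §§2–3, §5)
on top of the tree's resolution calculus (`Resolution.lean`: `IsResRefutation φ π`, `π` a list of
justified lines). Used to prove the Chvátal–Szemerédi theorem (`RandomCNFResolution.lean`,
`chvatal_szemeredi`).

* `ResDerivable F w E` — "`E` is derivable from the clause set `F` in width `≤ w`" (BSW `F ⊢_w E`,
  §2.3), as an inductive predicate on SET-clauses `Finset (Literal ν)` with the weakening rule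
  folded into the two rules (axiom download, resolution); the resolution rule is stated for a pivot
  literal `(v, b)` of either polarity.
* `SatisfiedBy ρ C`, `restrictClause ρ C`, `restrictFormula ρ F` — restrictions by a partial
  assignment `ρ : ν → Option Bool` (BSW §2.2): a clause containing a literal made true disappears,
  otherwise its assigned (= falsified) literals are removed.
* `resDerivable_restrict_of_isResRefutation` — a list refutation `π` of `φ` (tree calculus) yields,
  under any restriction `ρ`, a `ResDerivable (restrictFormula ρ (clauseSet φ)) W ∅` whenever every
  non-satisfied restricted line of `π` has width `≤ W` (BSW §2.2, "`π|ρ` is a refutation of `F|ρ`").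
* `ResDerivable.insert_of_update` (BSW Lemma 3.1) and `ResDerivable.of_split` (BSW Lemma 3.2).
* `IsFat d ρ C` (BSW proof of Thm 3.5: clauses of restricted width `> d`), `clauseVars C` (the
  variables of a set-clause), `SemImplies A I E` (BSW Def. 5.1: the clauses `A i`, `i ∈ I`,
  semantically imply `E`). Boundary expansion itself is the tree's `boundary` /
  `IsBoundaryExpander` of `ScopeExpansion.lean`, applied to the scope family `clauseVars ∘ A`.

Design: clauses inside derivations are `Finset`s (as in `Resolution.lean`); formulas fed to
`ResDerivable` are `Set`s of such clauses (`clauseSet φ` for a list CNF `φ`), so that restricted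
formulas are plain set images. Nothing here is specific to random formulas.

## References

* E. Ben-Sasson, A. Wigderson, *Short proofs are narrow — resolution made simple*, J. ACM 48
  (2001) 149–169, §2.2 (restrictions), §2.3 (width), Lemma 3.1, Lemma 3.2, §5 (boundary).
-/

namespace Literature.Computability.MetaComplexity

open Literature.Computability.Complexity

variable {ν : Type*}

/-! ### Width-bounded derivability -/

/-- `ResDerivable F w E`: the set-clause `E` is derivable from the clause set `F` by resolution with
weakening, all clauses having width (cardinality) at most `w` — BSW's `F ⊢_w E`. Weakening is
folded into both rules: `ax` downloads a superset of an axiom, `res` derives any superset of the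
resolvent `(C ∖ {x^b}) ∪ (D ∖ {x^{1-b}})` of `C ∋ x^b` and `D ∋ x^{1-b}`.
[Ben-Sasson–Wigderson 2001, §2.1, §2.3] [cite: BenSassonWigderson2001, §2.3] -/
inductive ResDerivable [DecidableEq ν] (F : Set (Finset (Literal ν))) (w : ℕ) :
    Finset (Literal ν) → Prop
  /-- axiom download (with weakening) -/
  | ax {A E : Finset (Literal ν)} (hA : A ∈ F) (hAE : A ⊆ E) (hE : E.card ≤ w) : ResDerivable F w E
  /-- resolution on the pivot literal `(v, b)` (with weakening) -/
  | res {C D E : Finset (Literal ν)} {v : ν} {b : Bool} (hC : ResDerivable F w C)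
      (hD : ResDerivable F w D) (hvC : (v, b) ∈ C) (hvD : (v, !b) ∈ D)
      (hsub : C.erase (v, b) ∪ D.erase (v, !b) ⊆ E) (hE : E.card ≤ w) : ResDerivable F w E

namespace ResDerivable

variable [DecidableEq ν] {F G : Set (Finset (Literal ν))} {w w' : ℕ} {C E : Finset (Literal ν)}

/-- ResDerivable clauses have width at most `w`. [Ben-Sasson–Wigderson 2001, §2.3] [folklore] -/
theorem card_le (h : ResDerivable F w E) : E.card ≤ w := by
  cases h <;> assumption

/-- Weakening inside the width bound. [Ben-Sasson–Wigderson 2001, §2.1 (weakening rule)]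
[folklore] -/
theorem weaken (h : ResDerivable F w C) (hCE : C ⊆ E) (hE : E.card ≤ w) : ResDerivable F w E := by
  cases h with
  | ax hA hAC _ => exact ax hA (hAC.trans hCE) hE
  | res hC hD hvC hvD hsub _ => exact res hC hD hvC hvD (hsub.trans hCE) hE

/-- Monotonicity in the width bound. [Ben-Sasson–Wigderson 2001, §2.3] [folklore] -/
theorem mono (h : ResDerivable F w E) (hw : w ≤ w') : ResDerivable F w' E := by
  induction h with
  | ax hA hAE hE => exact ax hA hAE (hE.trans hw)
  | res _ _ hvC hvD hsub hE ihC ihD => exact res ihC ihD hvC hvD hsub (hE.trans hw)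

/-- Cut: if every axiom of `F` of width `≤ w` is `G ⊢_w`-derivable, then `F ⊢_w E → G ⊢_w E`.
[Ben-Sasson–Wigderson 2001, proof of Lemma 3.2] [folklore] -/
theorem trans_axioms (hFG : ∀ A ∈ F, A.card ≤ w → ResDerivable G w A) (h : ResDerivable F w E) :
    ResDerivable G w E := by
  induction h with
  | ax hA hAE hE => exact (hFG _ hA ((Finset.card_le_card hAE).trans hE)).weaken hAE hE
  | res _ _ hvC hvD hsub hE ihC ihD => exact res ihC ihD hvC hvD hsub hE

/-- Monotonicity in the axiom set. [folklore] -/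
theorem mono_set (hFG : F ⊆ G) (h : ResDerivable F w E) : ResDerivable G w E :=
  h.trans_axioms fun _ hA hAw => ax (hFG hA) subset_rfl hAw

end ResDerivable

/-! ### Semantics of set-clauses -/

/-- Soundness of one (weakened) resolution step for set-clauses: an assignment satisfying
`C ∋ x^b` and `D ∋ x^{1-b}` satisfies every superset of the resolvent.
[Ben-Sasson–Wigderson 2001, §2.1] [folklore] -/
theorem finsetClauseEval_of_res [DecidableEq ν] {σ : ν → Bool} {C D E : Finset (Literal ν)}
    {v : ν} {b : Bool} (hC : finsetClauseEval σ C) (hD : finsetClauseEval σ D)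
    (hsub : C.erase (v, b) ∪ D.erase (v, !b) ⊆ E) : finsetClauseEval σ E := by
  obtain ⟨l₁, h₁, e₁⟩ := hC
  obtain ⟨l₂, h₂, e₂⟩ := hD
  by_cases hl₁ : l₁ = (v, b)
  · by_cases hl₂ : l₂ = (v, !b)
    · subst hl₁ hl₂
      simp [Literal.eval] at e₁ e₂
      rw [e₁] at e₂
      simp at e₂
    · exact ⟨l₂, hsub (Finset.mem_union_right _ (Finset.mem_erase.2 ⟨hl₂, h₂⟩)), e₂⟩
  · exact ⟨l₁, hsub (Finset.mem_union_left _ (Finset.mem_erase.2 ⟨hl₁, h₁⟩)), e₁⟩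

/-- The value of a set-clause depends only on the variables occurring in it.
[folklore] -/
theorem finsetClauseEval_update_iff {σ : ν → Bool} [DecidableEq ν] {C : Finset (Literal ν)}
    {x : ν} (hx : ∀ l ∈ C, l.1 ≠ x) (b : Bool) :
    finsetClauseEval (Function.update σ x b) C ↔ finsetClauseEval σ C := by
  unfold finsetClauseEval Literal.eval
  constructor
  · rintro ⟨l, hl, e⟩
    refine ⟨l, hl, ?_⟩
    rwa [Function.update_of_ne (hx l hl)] at e
  · rintro ⟨l, hl, e⟩
    refine ⟨l, hl, ?_⟩
    rwa [Function.update_of_ne (hx l hl)]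

/-- The clauses of a CNF, as a set of set-clauses (the axiom set fed to `ResDerivable`).
[Ben-Sasson–Wigderson 2001, §2.1] [folklore] -/
def clauseSet [DecidableEq ν] (φ : CNF ν) : Set (Finset (Literal ν)) :=
  {C | C ∈ φ.clauseFinsets}

/-- Membership in `clauseSet`. [folklore] -/
theorem mem_clauseSet_iff [DecidableEq ν] {φ : CNF ν} {C : Finset (Literal ν)} :
    C ∈ clauseSet φ ↔ ∃ c ∈ φ, c.toFinset = C := by
  simp [clauseSet, CNF.clauseFinsets]

/-! ### Restrictions -/

/-- The partial assignment `ρ` satisfies the set-clause `C`: some literal of `C` is made true.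
[Ben-Sasson–Wigderson 2001, §2.2] [folklore] -/
def SatisfiedBy (ρ : ν → Option Bool) (C : Finset (Literal ν)) : Prop :=
  ∃ l ∈ C, ρ l.1 = some l.2

/-- `SatisfiedBy` is decidable (a finite disjunction). [folklore] -/
instance (ρ : ν → Option Bool) (C : Finset (Literal ν)) : Decidable (SatisfiedBy ρ C) := by
  unfold SatisfiedBy; infer_instance

/-- The restriction `C|ρ` of a (non-satisfied) clause: the literals on unassigned variables.
[Ben-Sasson–Wigderson 2001, §2.2] [folklore] -/
def restrictClause (ρ : ν → Option Bool) (C : Finset (Literal ν)) : Finset (Literal ν) :=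
  C.filter fun l => ρ l.1 = none

/-- The restricted formula `F|ρ`: restrictions of the clauses of `F` not satisfied by `ρ`.
[Ben-Sasson–Wigderson 2001, §2.2] [folklore] -/
def restrictFormula (ρ : ν → Option Bool) (F : Set (Finset (Literal ν))) :
    Set (Finset (Literal ν)) :=
  {C' | ∃ C ∈ F, ¬ SatisfiedBy ρ C ∧ restrictClause ρ C = C'}

section Restrict

variable {ρ : ν → Option Bool} {C D : Finset (Literal ν)} {F : Set (Finset (Literal ν))}

/-- Membership in a restricted clause. [folklore] -/
@[simp] theorem mem_restrictClause {l : Literal ν} :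
    l ∈ restrictClause ρ C ↔ l ∈ C ∧ ρ l.1 = none := by
  simp [restrictClause]

/-- `C|ρ ⊆ C`. [folklore] -/
theorem restrictClause_subset : restrictClause ρ C ⊆ C := Finset.filter_subset _ _

/-- Restriction is monotone in the clause. [folklore] -/
theorem restrictClause_mono (h : C ⊆ D) : restrictClause ρ C ⊆ restrictClause ρ D :=
  Finset.filter_subset_filter _ h

/-- The empty clause restricts to the empty clause. [folklore] -/
@[simp] theorem restrictClause_empty : restrictClause ρ (∅ : Finset (Literal ν)) = ∅ := rfl

/-- Satisfaction is monotone in the clause. [folklore] -/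
theorem SatisfiedBy.mono (h : C ⊆ D) (hC : SatisfiedBy ρ C) : SatisfiedBy ρ D := by
  obtain ⟨l, hl, e⟩ := hC; exact ⟨l, h hl, e⟩

/-- The empty clause is never satisfied. [folklore] -/
theorem not_satisfiedBy_empty : ¬ SatisfiedBy ρ (∅ : Finset (Literal ν)) := by
  rintro ⟨l, hl, -⟩; simp at hl

/-- Restricted clauses are axioms of the restricted formula. [folklore] -/
theorem restrictClause_mem_restrictFormula (hC : C ∈ F) (hns : ¬ SatisfiedBy ρ C) :
    restrictClause ρ C ∈ restrictFormula ρ F := ⟨C, hC, hns, rfl⟩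

/-- Under the empty partial assignment nothing is satisfied. [folklore] -/
theorem not_satisfiedBy_none : ¬ SatisfiedBy (fun _ : ν => none) C := by
  rintro ⟨l, -, h⟩; simp at h

/-- Under the empty partial assignment restriction is the identity. [folklore] -/
@[simp] theorem restrictClause_none : restrictClause (fun _ : ν => none) C = C := by
  simp [restrictClause]

/-- `F|∅ = F`. [folklore] -/
@[simp] theorem restrictFormula_none : restrictFormula (fun _ : ν => none) F = F := by
  ext C
  simp [restrictFormula, not_satisfiedBy_none]

variable [DecidableEq ν] {x : ν} {b : Bool}

/-- Extending `ρ` at an unassigned variable keeps satisfied clauses satisfied. [folklore] -/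
theorem SatisfiedBy.update (hx : ρ x = none) (h : SatisfiedBy ρ C) :
    SatisfiedBy (Function.update ρ x (some b)) C := by
  obtain ⟨l, hl, e⟩ := h
  refine ⟨l, hl, ?_⟩
  have : l.1 ≠ x := by rintro h; rw [h, hx] at e; simp at e
  rwa [Function.update_of_ne this]

/-- Extending `ρ` shrinks restricted clauses. [folklore] -/
theorem restrictClause_update_subset (hx : ρ x = none) :
    restrictClause (Function.update ρ x (some b)) C ⊆ restrictClause ρ C := by
  intro l hl
  rw [mem_restrictClause] at hl ⊢
  refine ⟨hl.1, ?_⟩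
  by_cases h : l.1 = x
  · rw [h]; exact hx
  · rw [Function.update_of_ne h] at hl
    exact hl.2

/-- A literal on the newly assigned variable in a clause NOT satisfied by the extension has the
falsified polarity. [folklore] -/
theorem eq_not_of_not_satisfiedBy_update {l : Literal ν}
    (hns : ¬ SatisfiedBy (Function.update ρ x (some b)) C) (hl : l ∈ C) (hlx : l.1 = x) :
    l = (x, !b) := by
  have hne : l.2 ≠ b := by
    intro h2
    exact hns ⟨l, hl, by rw [hlx, Function.update_self, h2]⟩
  ext
  · exact hlx
  · exact Bool.eq_not_iff.2 hne

/-- Un-restricting one variable: `C|ρ ⊆ (C|ρ[x:=b]) ∪ {x^{1-b}}` for clauses not satisfied by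
`ρ[x:=b]`. [Ben-Sasson–Wigderson 2001, proof of Lemma 3.1] [folklore] -/
theorem restrictClause_subset_insert (hns : ¬ SatisfiedBy (Function.update ρ x (some b)) C) :
    restrictClause ρ C ⊆ insert (x, !b) (restrictClause (Function.update ρ x (some b)) C) := by
  intro l hl
  rw [mem_restrictClause] at hl
  by_cases h : l.1 = x
  · rw [eq_not_of_not_satisfiedBy_update hns hl.1 h]
    exact Finset.mem_insert_self _ _
  · refine Finset.mem_insert_of_mem (mem_restrictClause.2 ⟨hl.1, ?_⟩)
    rw [Function.update_of_ne h]
    exact hl.2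

/-- Restricting one more variable of the falsified polarity erases that literal:
`C|ρ[x:=b] = (C|ρ) ∖ {x^{1-b}}` for clauses not satisfied by `ρ[x:=b]`.
[Ben-Sasson–Wigderson 2001, proof of Lemma 3.2] [folklore] -/
theorem restrictClause_update_eq_erase
    (hns : ¬ SatisfiedBy (Function.update ρ x (some b)) C) :
    restrictClause (Function.update ρ x (some b)) C = (restrictClause ρ C).erase (x, !b) := by
  ext l
  rw [Finset.mem_erase, mem_restrictClause, mem_restrictClause]
  constructor
  · rintro ⟨hl, hρ⟩
    have hne : l.1 ≠ x := by
      intro h; rw [h, Function.update_self] at hρ; simp at hρ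
    rw [Function.update_of_ne hne] at hρ
    exact ⟨fun h => hne (by rw [h]), hl, hρ⟩
  · rintro ⟨hne, hl, hρ⟩
    refine ⟨hl, ?_⟩
    by_cases h : l.1 = x
    · exact absurd (eq_not_of_not_satisfiedBy_update hns hl h) hne
    · rwa [Function.update_of_ne h]

end Restrict

/-! ### List refutations restrict to width-bounded derivations -/

/-- **Restricting a refutation** (BSW §2.2): if `π` is a resolution refutation of `φ` in the
tree's calculus and every line of `π` not satisfied by `ρ` restricts to a clause of width `≤ W`,
then the empty clause is `W`-derivable from `φ|ρ`. (Lines satisfied by `ρ` are dropped; a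
resolution step on an assigned pivot becomes a weakening.)
[Ben-Sasson–Wigderson 2001, §2.2] [cite: BenSassonWigderson2001, §2.2] -/
theorem resDerivable_restrict_of_isResRefutation [DecidableEq ν] {φ : CNF ν}
    {π : List (ResLine ν)} (hπ : IsResRefutation φ π) (ρ : ν → Option Bool) {W : ℕ}
    (hW : ∀ l ∈ π, ¬ SatisfiedBy ρ l.clause → (restrictClause ρ l.clause).card ≤ W) :
    ResDerivable (restrictFormula ρ (clauseSet φ)) W ∅ := by
  obtain ⟨hder, l₀, hl₀, hl₀e⟩ := hπ
  have key : ∀ i (hi : i < π.length), ¬ SatisfiedBy ρ (π[i]).clause →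
      ResDerivable (restrictFormula ρ (clauseSet φ)) W (restrictClause ρ (π[i]).clause) := by
    intro i
    induction i using Nat.strong_induction_on with
    | _ i ih =>
      intro hi hns
      have hv := hder i hi
      have hWi := hW _ (List.getElem_mem hi) hns
      unfold IsValidResLine at hv
      split at hv
      · exact ResDerivable.ax ⟨_, hv, hns, rfl⟩ subset_rfl hWi
      · rename_i j₁ j₂ v _
        obtain ⟨hj₁, hj₂, hv1, hv2, hE⟩ := hv
        rw [List.length_take] at hj₁ hj₂
        have hj₁i : j₁ < i := lt_of_lt_of_le hj₁ (min_le_left _ _)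
        have hj₂i : j₂ < i := lt_of_lt_of_le hj₂ (min_le_left _ _)
        have hj₁' : j₁ < π.length := lt_of_lt_of_le hj₁ (min_le_right _ _)
        have hj₂' : j₂ < π.length := lt_of_lt_of_le hj₂ (min_le_right _ _)
        simp only [List.getElem_take] at hv1 hv2 hE
        -- name the premise clauses
        set C₁ := (π[j₁]).clause with hC₁
        set C₂ := (π[j₂]).clause with hC₂
        set E := (π[i]).clause with hEdef
        rcases hρv : ρ v with _ | bv
        · -- pivot unassigned: a genuine resolution step on the restricted premises
          have hns₁ : ¬ SatisfiedBy ρ C₁ := by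
            rintro ⟨l, hl, hρl⟩
            refine hns ⟨l, ?_, hρl⟩
            rw [hE]
            refine Finset.mem_union_left _ (Finset.mem_erase.2 ⟨?_, hl⟩)
            rintro rfl
            rw [hρv] at hρl; simp at hρl
          have hns₂ : ¬ SatisfiedBy ρ C₂ := by
            rintro ⟨l, hl, hρl⟩
            refine hns ⟨l, ?_, hρl⟩
            rw [hE]
            refine Finset.mem_union_right _ (Finset.mem_erase.2 ⟨?_, hl⟩)
            rintro rfl
            rw [hρv] at hρl; simp at hρl
          refine ResDerivable.res (ih j₁ hj₁i hj₁' hns₁) (ih j₂ hj₂i hj₂' hns₂)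
            (mem_restrictClause.2 ⟨hv1, hρv⟩) (mem_restrictClause.2 ⟨hv2, hρv⟩) ?_ hWi
          intro l hl
          rw [mem_restrictClause, hE]
          rcases Finset.mem_union.1 hl with h | h
          · obtain ⟨hne, hl'⟩ := Finset.mem_erase.1 h
            obtain ⟨hlC, hρl⟩ := mem_restrictClause.1 hl'
            exact ⟨Finset.mem_union_left _ (Finset.mem_erase.2 ⟨hne, hlC⟩), hρl⟩
          · obtain ⟨hne, hl'⟩ := Finset.mem_erase.1 h
            obtain ⟨hlC, hρl⟩ := mem_restrictClause.1 hl'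
            exact ⟨Finset.mem_union_right _ (Finset.mem_erase.2 ⟨hne, hlC⟩), hρl⟩
        · cases bv with
          | true =>
            -- `C₁ ∋ (v, true)` is satisfied; `E|ρ ⊇ C₂|ρ`
            have hns₂ : ¬ SatisfiedBy ρ C₂ := by
              rintro ⟨l, hl, hρl⟩
              refine hns ⟨l, ?_, hρl⟩
              rw [hE]
              refine Finset.mem_union_right _ (Finset.mem_erase.2 ⟨?_, hl⟩)
              rintro rfl
              rw [hρv] at hρl; simp at hρl
            refine (ih j₂ hj₂i hj₂' hns₂).weaken ?_ hWi
            intro l hl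
            obtain ⟨hlC, hρl⟩ := mem_restrictClause.1 hl
            rw [mem_restrictClause, hE]
            refine ⟨Finset.mem_union_right _ (Finset.mem_erase.2 ⟨?_, hlC⟩), hρl⟩
            rintro rfl
            rw [hρv] at hρl; simp at hρl
          | false =>
            have hns₁ : ¬ SatisfiedBy ρ C₁ := by
              rintro ⟨l, hl, hρl⟩
              refine hns ⟨l, ?_, hρl⟩
              rw [hE]
              refine Finset.mem_union_left _ (Finset.mem_erase.2 ⟨?_, hl⟩)
              rintro rfl
              rw [hρv] at hρl; simp at hρl
            refine (ih j₁ hj₁i hj₁' hns₁).weaken ?_ hWi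
            intro l hl
            obtain ⟨hlC, hρl⟩ := mem_restrictClause.1 hl
            rw [mem_restrictClause, hE]
            refine ⟨Finset.mem_union_left _ (Finset.mem_erase.2 ⟨?_, hlC⟩), hρl⟩
            rintro rfl
            rw [hρv] at hρl; simp at hρl
      · rename_i j _
        obtain ⟨hj, hsub⟩ := hv
        rw [List.length_take] at hj
        have hji : j < i := lt_of_lt_of_le hj (min_le_left _ _)
        have hj' : j < π.length := lt_of_lt_of_le hj (min_le_right _ _)
        rw [List.getElem_take] at hsub
        have hnsj : ¬ SatisfiedBy ρ (π[j]).clause := fun h => hns (h.mono hsub)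
        exact (ih j hji hj' hnsj).weaken (restrictClause_mono hsub) hWi
  obtain ⟨i, hi, rfl⟩ := List.mem_iff_getElem.1 hl₀
  have h := key i hi (by rw [hl₀e]; exact not_satisfiedBy_empty)
  rwa [hl₀e, restrictClause_empty] at h

/-! ### BSW Lemmas 3.1 and 3.2 -/

/-- **BSW Lemma 3.1.** If `F|ρ[x:=b] ⊢_w C` then `F|ρ ⊢_{w+1} C ∨ x^{1-b}` (`x` unassigned in
`ρ`). [Ben-Sasson–Wigderson 2001, Lemma 3.1] [cite: BenSassonWigderson2001, Lemma 3.1] -/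
theorem ResDerivable.insert_of_update [DecidableEq ν] {F : Set (Finset (Literal ν))}
    {ρ : ν → Option Bool} {x : ν} (hx : ρ x = none) {b : Bool} {w : ℕ} {C : Finset (Literal ν)}
    (h : ResDerivable (restrictFormula (Function.update ρ x (some b)) F) w C) :
    ResDerivable (restrictFormula ρ F) (w + 1) (insert (x, !b) C) := by
  induction h with
  | ax hA hAE hE =>
    obtain ⟨D, hD, hnsD, rfl⟩ := hA
    have hnsρ : ¬ SatisfiedBy ρ D := fun h => hnsD (h.update hx)
    refine ResDerivable.ax (restrictClause_mem_restrictFormula hD hnsρ)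
      ((restrictClause_subset_insert hnsD).trans (Finset.insert_subset_insert _ hAE))
      ((Finset.card_insert_le _ _).trans (by omega))
  | res _ _ hvC hvD hsub hE ihC ihD =>
    refine ResDerivable.res ihC ihD (Finset.mem_insert_of_mem hvC) (Finset.mem_insert_of_mem hvD)
      ?_ ((Finset.card_insert_le _ _).trans (by omega))
    intro l hl
    rcases Finset.mem_union.1 hl with h | h
    · obtain ⟨hne, hl'⟩ := Finset.mem_erase.1 h
      rcases Finset.mem_insert.1 hl' with rfl | hlC
      · exact Finset.mem_insert_self _ _
      · exact Finset.mem_insert_of_mem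
          (hsub (Finset.mem_union_left _ (Finset.mem_erase.2 ⟨hne, hlC⟩)))
    · obtain ⟨hne, hl'⟩ := Finset.mem_erase.1 h
      rcases Finset.mem_insert.1 hl' with rfl | hlC
      · exact Finset.mem_insert_self _ _
      · exact Finset.mem_insert_of_mem
          (hsub (Finset.mem_union_right _ (Finset.mem_erase.2 ⟨hne, hlC⟩)))

/-- **BSW Lemma 3.2.** If `F|ρ[x:=b] ⊢_w 0`, `F|ρ[x:=1-b] ⊢_{w+1} 0` and `w(F) ≤ w + 1`, then
`F|ρ ⊢_{w+1} 0` (`x` unassigned in `ρ`): derive the unit clause `x^{1-b}` by Lemma 3.1, resolve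
it against the axioms of `F|ρ` containing `x^b` to obtain the axioms of `F|ρ[x:=1-b]`, and replay
the second refutation. [Ben-Sasson–Wigderson 2001, Lemma 3.2] [cite: BenSassonWigderson2001, Lemma 3.2] -/
theorem ResDerivable.of_split [DecidableEq ν] {F : Set (Finset (Literal ν))}
    {ρ : ν → Option Bool} {x : ν} (hx : ρ x = none) {b : Bool} {w : ℕ}
    (hF : ∀ D ∈ F, D.card ≤ w + 1)
    (h1 : ResDerivable (restrictFormula (Function.update ρ x (some b)) F) w ∅)
    (h2 : ResDerivable (restrictFormula (Function.update ρ x (some !b)) F) (w + 1) ∅) :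
    ResDerivable (restrictFormula ρ F) (w + 1) ∅ := by
  have hunit : ResDerivable (restrictFormula ρ F) (w + 1) {(x, !b)} := by
    simpa using h1.insert_of_update hx
  refine h2.trans_axioms fun A hA hAw => ?_
  obtain ⟨D, hD, hnsD, rfl⟩ := hA
  have hnsρ : ¬ SatisfiedBy ρ D := fun h => hnsD (h.update hx)
  have hax : ResDerivable (restrictFormula ρ F) (w + 1) (restrictClause ρ D) :=
    ResDerivable.ax (restrictClause_mem_restrictFormula hD hnsρ) subset_rfl
      ((Finset.card_le_card restrictClause_subset).trans (hF D hD))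
  have key := restrictClause_update_eq_erase hnsD
  rw [Bool.not_not] at key
  by_cases hxb : (x, b) ∈ restrictClause ρ D
  · refine ResDerivable.res hax hunit hxb (Finset.mem_singleton_self _) ?_ hAw
    rw [key]
    intro l hl
    rcases Finset.mem_union.1 hl with h | h
    · exact h
    · simp at h
  · rw [key, Finset.erase_eq_of_notMem hxb]
    exact hax

/-! ### Fat clauses, clause variables, semantic implication -/

/-- A clause is `d`-FAT under `ρ` if it is not satisfied by `ρ` and its restriction has more
than `d` literals (BSW, proof of Thm 3.5: the set `π*` of fat clauses of `π|ρ`).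
[Ben-Sasson–Wigderson 2001, proof of Thm 3.5] [folklore] -/
def IsFat (d : ℕ) (ρ : ν → Option Bool) (C : Finset (Literal ν)) : Prop :=
  ¬ SatisfiedBy ρ C ∧ d < (restrictClause ρ C).card

/-- Fatness is decidable. [folklore] -/
instance (d : ℕ) (ρ : ν → Option Bool) (C : Finset (Literal ν)) : Decidable (IsFat d ρ C) := by
  unfold IsFat; infer_instance

/-- The variables occurring in a set-clause. [Ben-Sasson–Wigderson 2001, §2.1 (`x ∈ C`)]
[folklore] -/
def clauseVars [DecidableEq ν] (C : Finset (Literal ν)) : Finset ν :=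
  C.image Prod.fst

/-- Membership in `clauseVars`. [folklore] -/
theorem mem_clauseVars_iff [DecidableEq ν] {C : Finset (Literal ν)} {x : ν} :
    x ∈ clauseVars C ↔ ∃ l ∈ C, l.1 = x := by
  simp [clauseVars]

/-- `|vars(C)| ≤ |C|`. [folklore] -/
theorem card_clauseVars_le [DecidableEq ν] (C : Finset (Literal ν)) :
    (clauseVars C).card ≤ C.card :=
  Finset.card_image_le

/-- Semantic implication `A_I ⊨ E`: every total assignment satisfying the clauses `A i`, `i ∈ I`,
satisfies `E` (BSW §5, Def. 5.1, for sets of clauses). [Ben-Sasson–Wigderson 2001, Def. 5.1]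
[cite: BenSassonWigderson2001, Def. 5.1] -/
def SemImplies {ι : Type*} (A : ι → Finset (Literal ν)) (I : Finset ι) (E : Finset (Literal ν)) :
    Prop :=
  ∀ σ : ν → Bool, (∀ i ∈ I, finsetClauseEval σ (A i)) → finsetClauseEval σ E

/-- Implication is monotone in the index set. [folklore] -/
theorem SemImplies.mono {ι : Type*} {A : ι → Finset (Literal ν)} {I J : Finset ι}
    {E : Finset (Literal ν)} (h : SemImplies A I E) (hIJ : I ⊆ J) : SemImplies A J E :=
  fun σ hσ => h σ fun i hi => hσ i (hIJ hi)

/-- Implication is monotone in the conclusion (weakening). [folklore] -/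
theorem SemImplies.weaken {ι : Type*} {A : ι → Finset (Literal ν)} {I : Finset ι}
    {C E : Finset (Literal ν)} (h : SemImplies A I C) (hCE : C ⊆ E) : SemImplies A I E :=
  fun σ hσ => by obtain ⟨l, hl, e⟩ := h σ hσ; exact ⟨l, hCE hl, e⟩

end Literature.Computability.MetaComplexity
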